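import Mathlib
import Literature.NumberTheory.LFunctions.DeBruijnNewmanProofs

/-!
# NE9RealSupNoGo — census row E13 of the NE9 binder (node U3, cell `pub-balaban`, rung (B)+1 on a finite T⁴), certified:
# NO Bernstein inequality controls the REAL-axis derivative of a function analytic and bounded on a strip by its REAL-axis
# sup — the logarithmic loss of the two-constants interpolation is SHARP (witness `m·sin(λz)`)

HONEST FRAMING (T4-DAG PAGE 1).  Rung (B)+1 on a fixed finite torus; NOT infinite volume, NOT the mass gap, NOT Clay.  OUR OWN
WORK (Summits-side; prover seat of binder row NE9, unit `b2b-balaban-t4-ne9-p1-g17`); [folklore] complex analysis over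
Mathlib (+ the tree lemma `Literature.NumberTheory.LFunctions.norm_sin_le_exp_abs_im`, `‖sin z‖ ≤ e^{|Im z|}`); nothing of Bałaban's construction is modelled and nothing printed in the audited manuscripts is used.

WHY (cell record `t4/T4-EST-NE9-P1.md`, gen 17, census rows E12–E13).  Scheme (IV) for the spine estimate NE9
(`Support/NE9FluctuationStep.lean`, p197659) gets the last-coupling and old-action moduli of a fluctuation step of the
printed form by POSITIVITY, at REAL backgrounds, in the sup norm over real data.  The induction that turns the one-step
inequality into NE9 with FADING MEMORY needs, at every step, the CONTRACTION of the fluctuation difference of the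
coupling-DISCREPANCY `W_j = 𝐄^{(j)}(g) − 𝐄^{(j)}(g′)` of the old terms, i.e. a bound on a BACKGROUND-derivative (or a
small background-difference) of `W_j` that is LINEAR in the real-sup size `m ≍ Λ|g − g′|` of `W_j`.  Print's own device
for background-derivatives is analyticity on the complex spaces `U^c_j(X, α₀, α₁)` plus a Cauchy estimate, which needs the
COMPLEX-sup of `W_j` — and scheme (IV) supplies only the REAL-sup `m` (the complex-sup of `W_j` is the trivial `2E₀`-type
size bound `M`, carrying no factor `|g − g′|`).  The cheapest conceivable repair is an interpolation inequality «analytic and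
`≤ M` on a strip of width `α`, `≤ m` on the real axis ⇒ real derivative `≤ K(α, M)·m`».  This leaf shows in the kernel
that NO such inequality exists: for every `α > 0` and every `K` there is an ENTIRE `f` with `‖f‖ ≤ 1` on the strip
`|Im z| ≤ α`, `‖f‖ ≤ m` on `ℝ` for some `m > 0`, and `‖f′(0)‖ > K·m` (`no_realSup_bernstein`; the witness `m·sin(λz)` with
`λ = |K| + 1`, `m = e^{−λα}` realises the two-constants rate `f′(0) = (m/α)·log(1/m)` exactly).  Consequence for the census:
an NE9 induction cannot run on real-sup discrepancy bounds plus printed complex-sup size bounds; it must carry either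
complex-domain discrepancy bounds (complex integrand ⇒ the linear response of the expansion of [Balaban1988RG2Cluster] §2,
(L6)-class, NOT PRINTED) or background-moduli of the discrepancy as induction data (mixed moduli; for localized terms again
through the expansion).  This closes the interpolation loophole; it asserts nothing else.
-/

namespace Summit.QuantumFields.BalabanUV.T4Continuum.NE9RealSupNoGo

open Literature.NumberTheory.LFunctions (norm_sin_le_exp_abs_im)

/-- THE WITNESS FAMILY `witness m λ z = m·sin(λz)` (real parameters `m`, `λ`). [folklore] -/
noncomputable def witness (m lam : ℝ) (z : ℂ) : ℂ := (m : ℂ) * Complex.sin ((lam : ℂ) * z)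

/-- The witness is entire. [folklore] -/
theorem differentiable_witness (m lam : ℝ) : Differentiable ℂ (witness m lam) := by
  unfold witness
  fun_prop

/-- On the real axis the witness is bounded by `|m|` (`|sin x| ≤ 1` for real `x`). [folklore] -/
theorem norm_witness_real_le (m lam x : ℝ) : ‖witness m lam (x : ℂ)‖ ≤ |m| := by
  unfold witness
  rw [norm_mul, Complex.norm_real, Real.norm_eq_abs]
  have : ‖Complex.sin ((lam : ℂ) * (x : ℂ))‖ ≤ 1 := by
    rw [← Complex.ofReal_mul, ← Complex.ofReal_sin, Complex.norm_real, Real.norm_eq_abs]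
    exact Real.abs_sin_le_one _
  calc |m| * ‖Complex.sin ((lam : ℂ) * (x : ℂ))‖ ≤ |m| * 1 := mul_le_mul_of_nonneg_left this (abs_nonneg m)
    _ = |m| := mul_one _

/-- On the strip `|Im z| ≤ α` the witness is bounded by `|m|·e^{λα}` (for `λ ≥ 0`). [folklore] -/
theorem norm_witness_strip_le {m lam α : ℝ} (hlam : 0 ≤ lam) {z : ℂ} (hz : |z.im| ≤ α) :
    ‖witness m lam z‖ ≤ |m| * Real.exp (lam * α) := by
  unfold witness
  rw [norm_mul, Complex.norm_real, Real.norm_eq_abs]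
  refine mul_le_mul_of_nonneg_left ?_ (abs_nonneg m)
  refine (norm_sin_le_exp_abs_im _).trans (Real.exp_le_exp.mpr ?_)
  have him : ((lam : ℂ) * z).im = lam * z.im := by simp
  rw [him, abs_mul, abs_of_nonneg hlam]
  exact mul_le_mul_of_nonneg_left hz hlam

/-- The derivative of the witness at the origin is `m·λ`. [folklore] -/
theorem deriv_witness_zero (m lam : ℝ) : deriv (witness m lam) 0 = (m : ℂ) * (lam : ℂ) := by
  have h1 : HasDerivAt (fun z : ℂ => (lam : ℂ) * z) (lam : ℂ) 0 := by
    simpa using (hasDerivAt_id (0 : ℂ)).const_mul (lam : ℂ)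
  have h2 : HasDerivAt (fun z : ℂ => Complex.sin ((lam : ℂ) * z)) (Complex.cos ((lam : ℂ) * 0) * (lam : ℂ)) 0 :=
    (Complex.hasDerivAt_sin _).comp 0 h1
  have h3 : HasDerivAt (witness m lam) ((m : ℂ) * (Complex.cos ((lam : ℂ) * 0) * (lam : ℂ))) 0 :=
    h2.const_mul (m : ℂ)
  rw [h3.deriv]
  simp

/-- **NO REAL-SUP BERNSTEIN INEQUALITY ON A STRIP (census E13 certified).**  For every strip half-width `α` (no sign needed) and every
constant `K` there is an entire function bounded by `1` on the closed strip `|Im z| ≤ α` and by some `m > 0` on the real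
axis whose derivative at `0` exceeds `K·m` in norm: the real-axis derivative of a strip-bounded analytic function is NOT
controlled linearly by its real-axis sup (the two-constants bound `(m/α)·log(M/m)` is attained by `m·sin(λz)`,
`λ = log(M/m)/α`).  Witness: `λ = |K| + 1`, `m = e^{−λα}`. [folklore] -/
theorem no_realSup_bernstein (α K : ℝ) :
    ∃ f : ℂ → ℂ, Differentiable ℂ f ∧ ∃ m : ℝ, 0 < m ∧
      (∀ z : ℂ, |z.im| ≤ α → ‖f z‖ ≤ 1) ∧ (∀ x : ℝ, ‖f (x : ℂ)‖ ≤ m) ∧ K * m < ‖deriv f 0‖ := by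
  set lam : ℝ := |K| + 1 with hlam_def
  have hlam : 0 < lam := by positivity
  set m : ℝ := Real.exp (-(lam * α)) with hm_def
  have hm : 0 < m := Real.exp_pos _
  refine ⟨witness m lam, differentiable_witness m lam, m, hm, ?_, ?_, ?_⟩
  · intro z hz
    calc ‖witness m lam z‖ ≤ |m| * Real.exp (lam * α) := norm_witness_strip_le hlam.le hz
      _ = 1 := by rw [abs_of_pos hm, hm_def, ← Real.exp_add]; simp
  · intro x
    simpa [abs_of_pos hm] using norm_witness_real_le m lam x
  · rw [deriv_witness_zero, norm_mul, Complex.norm_real, Complex.norm_real, Real.norm_eq_abs, Real.norm_eq_abs,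
      abs_of_pos hm, abs_of_pos hlam]
    have hK : K < lam := by rw [hlam_def]; linarith [le_abs_self K]
    nlinarith

end Summit.QuantumFields.BalabanUV.T4Continuum.NE9RealSupNoGo
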